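import Summits.QuantumFields.YangMills.Theorems.ColdStartUniversalityUniformColdStartMixingRung
import Summits.QuantumFields.YangMills.Theorems.ColdStartUniversalityUniformColdStartMixingDictionary
import Literature.MathematicalPhysics.QuantumFieldTheory.Balaban1983to89.T4GenFunBounds
import HarnessLib

/-!
# Route `ColdStartUniversality`, crux K_A1 `UniformColdStartMixing` (stmt-QuantumFields-24809), rung
# `stub_fixedCutoffMixing`: inputs (D) and (R) discharged — the rung from lattice-time ergodicity ALONE

Helper file (lead `ym-line-csu-p1`).  Of the three inputs of the landed reduction
`fixedCutoffMixing_of_latticeErgodic` (`…UniformColdStartMixingRung`):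

* (D) the Gibbs dictionary is the theorem `expectAt_eq_integral_wilsonMeasure` (`…UniformColdStartMixingDictionary`);
* (R) measurability and the bound `|∏ avgObs| ≤ 1` of the product observable read through the bond dictionary
  is `measurable_prodAvgObs_pullback` / `abs_prodAvgObs_pullback_le_one` below (tree: `measurable_avgObs` from
  `avgMeasurable_of_measurableE` + `T4ApexTwoLevel.measurableE_expMeanLogSU`, and `abs_avgObs_le_one`, through
  `T4GenFunBounds.measurable_prodObs` / `abs_prodObs_le_one`);

so the plan-only rung of K_A1 is reduced to the single analytic input (E): lattice-time cold-start Cesàro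
ergodicity of the SU(2) SZZ diffusion with limit the Wilson measure (`fixedCutoffMixing_of_latticeErgodic'`).
No definition, no sorry, standard axioms.  RECORD-rung R3 plumbing; NOT K_A1, not the mass gap.
-/

set_option autoImplicit false

noncomputable section

namespace Summit.QuantumFields.YangMills.Theorems.ColdStartUniversality

open MeasureTheory ProbabilityTheory intervalIntegral
open scoped NNReal
open Literature.MathematicalPhysics.QuantumFieldTheory
open Literature.MathematicalPhysics.QuantumLattice (fundamentalRep fundamentalLatticeRep)
open Literature.MathematicalPhysics.QuantumFieldTheory.Balaban1983to89

/-- **(R), measurability**: the product of averaged loop variables, read through the bond dictionary, is a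
measurable function of the `Edge`-indexed configuration. [folklore] -/
theorem measurable_prodAvgObs_pullback (F : T3ContinuumYM3Torus.T3Family) (K : ℕ)
    (os : List (T3ContinuumYM3Torus.ULoop3 F)) :
    Measurable (fun V : GaugeConfig 3 ((F.P K).sitesPerDir 0) (Matrix.specialUnitaryGroup (Fin 2) ℂ) =>
      (os.map fun C => F.avgObs (ExpMeanLog.expMeanLogSU :
          LoopAverage (Matrix.specialUnitaryGroup (Fin 2) ℂ)) K C
        (fun b : PBond (F.P K) 0 => V (b.src, b.dir))).prod) := by
  have hm : ∀ K' C, Measurable ((F.scheme (ExpMeanLog.expMeanLogSU :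
      LoopAverage (Matrix.specialUnitaryGroup (Fin 2) ℂ)) 1).obs K' C) := fun K' C =>
    F.measurable_avgObs (F.avgMeasurable_of_measurableE _ T4ApexTwoLevel.measurableE_expMeanLogSU) K' C
  have hprod := T4GenFunBounds.measurable_prodObs
    (F.scheme (ExpMeanLog.expMeanLogSU : LoopAverage (Matrix.specialUnitaryGroup (Fin 2) ℂ)) 1) hm K os
  have hΦ : Measurable fun V : GaugeConfig 3 ((F.P K).sitesPerDir 0) (Matrix.specialUnitaryGroup (Fin 2) ℂ) =>
      (fun b : PBond (F.P K) 0 => V (b.src, b.dir) : GaugeField (F.P K) 0 (Matrix.specialUnitaryGroup (Fin 2) ℂ)) :=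
    measurable_pi_lambda _ fun b => measurable_pi_apply _
  exact hprod.comp hΦ

/-- **(R), boundedness**: `|∏_{C ∈ os} avgObs K C| ≤ 1` (each factor is a normalised trace). [folklore] -/
theorem abs_prodAvgObs_pullback_le_one (F : T3ContinuumYM3Torus.T3Family) (K : ℕ)
    (os : List (T3ContinuumYM3Torus.ULoop3 F))
    (V : GaugeConfig 3 ((F.P K).sitesPerDir 0) (Matrix.specialUnitaryGroup (Fin 2) ℂ)) :
    |(os.map fun C => F.avgObs (ExpMeanLog.expMeanLogSU :
        LoopAverage (Matrix.specialUnitaryGroup (Fin 2) ℂ)) K C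
      (fun b : PBond (F.P K) 0 => V (b.src, b.dir))).prod| ≤ 1 :=
  T4GenFunBounds.abs_prodObs_le_one
    (F.scheme (ExpMeanLog.expMeanLogSU : LoopAverage (Matrix.specialUnitaryGroup (Fin 2) ℂ)) 1)
    (fun K' C U => F.abs_avgObs_le_one _ K' C U) K os _

/-- **The rung `stub_fixedCutoffMixing` from lattice-time ergodicity ALONE** (inputs (D), (R) discharged):
if the cold-start SZZ diffusion for `SU(2)` on every `(ℤ/L)³` at every coupling is Cesàro-ergodic in lattice time
for bounded measurable observables with limit `wilsonMeasure (fundamentalRep (Fin 2)) β'`, then for every `F`,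
`γ > 0`, `os`, `δ > 0`, `K` there is a physical time `T > 0` with
`|expectAt K os − T⁻¹ ∫₀ᵀ E[∏ avgObs (U(s/ε_K))] ds| ≤ δ` for every cold-start strong solution at
`β' = (γ ε_K)⁻¹/2`. -/
theorem fixedCutoffMixing_of_latticeErgodic'
    (hErg : ∀ (L : ℕ) [NeZero L] (β' : ℝ)
      (f : GaugeConfig 3 L (Matrix.specialUnitaryGroup (Fin 2) ℂ) → ℝ), Measurable f → (∀ V, |f V| ≤ 1) →
      ∀ δ : ℝ, 0 < δ → ∃ T₀ : ℝ, 0 < T₀ ∧ ∀ T : ℝ, T₀ ≤ T →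
        ∀ (Ω : Type) (mΩ : MeasurableSpace Ω) (P : Measure Ω) (hP : IsProbabilityMeasure P)
          (W : ℝ≥0 → Ω → (Edge 3 L × NoiseIdx 2 → ℝ)) (hW : IsFlatBrownian W P)
          (U : ℝ≥0 → Ω → GaugeConfig 3 L (Matrix.specialUnitaryGroup (Fin 2) ℂ)),
          (∀ ω, U 0 ω = fun _ => 1) →
          (latticeLangevinDynamics (fundamentalLatticeRep 2) β').IsSolution (fundamentalRep (Fin 2))
            hW.natFiltration P W U →
          |(∫ V, f V ∂(wilsonMeasure (d := 3) (L := L) (fundamentalRep (Fin 2)) β')) -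
              T⁻¹ * ∫ t in (0 : ℝ)..T, (∫ ω, f (U t.toNNReal ω) ∂P)| ≤ δ) :
    ∀ (F : T3ContinuumYM3Torus.T3Family) (γ : ℝ), 0 < γ →
      ∀ (os : List (T3ContinuumYM3Torus.ULoop3 F)) (δ : ℝ), 0 < δ → ∀ K : ℕ, ∃ T : ℝ, 0 < T ∧
        ∀ (Ω : Type) (mΩ : MeasurableSpace Ω) (P : Measure Ω) (hP : IsProbabilityMeasure P)
          (W : ℝ≥0 → Ω → (Edge 3 ((F.P K).sitesPerDir 0) × NoiseIdx 2 → ℝ)) (hW : IsFlatBrownian W P)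
          (U : ℝ≥0 → Ω → GaugeConfig 3 ((F.P K).sitesPerDir 0) (Matrix.specialUnitaryGroup (Fin 2) ℂ)),
          (∀ ω, U 0 ω = fun _ => 1) →
          (latticeLangevinDynamics (fundamentalLatticeRep 2) ((γ * (F.P K).eps)⁻¹ / 2)).IsSolution
            (fundamentalRep (Fin 2)) hW.natFiltration P W U →
          |(F.scheme (ExpMeanLog.expMeanLogSU : LoopAverage (Matrix.specialUnitaryGroup (Fin 2) ℂ)) γ).expectAt
                K os -
              T⁻¹ * ∫ s in (0 : ℝ)..T, (∫ ω, (os.map fun C => F.avgObs (ExpMeanLog.expMeanLogSU :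
                  LoopAverage (Matrix.specialUnitaryGroup (Fin 2) ℂ)) K C
                (fun b : PBond (F.P K) 0 => U (s / (F.P K).eps).toNNReal ω (b.src, b.dir))).prod ∂P)| ≤ δ :=
  fixedCutoffMixing_of_latticeErgodic hErg expectAt_eq_integral_wilsonMeasure
    fun F K os => ⟨measurable_prodAvgObs_pullback F K os, abs_prodAvgObs_pullback_le_one F K os⟩

end Summit.QuantumFields.YangMills.Theorems.ColdStartUniversality

end
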